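import Mathlib.Data.Nat.Notation
import Mathlib.Data.Int.Notation
import HarnessLib

/-!
# X11 at rank one beyond `p = 3` — per-pair certificate records: the record schema and its in-kernel recheck

HONEST FRAMING (cell `b2b-bsdres`, run/shared/lean/b2b/bsd-rank1-residual/, verbatim): prove what is
provable now; shrink each hard class to its core with data; no claim beyond stated classes. The goal of
the cell is to DELETE the COMBINATION-SHAPED residual classes of the BSD formula for analytic-rank `≤ 1`
curves over `ℚ` from PUBLISHED theorems only; the CONSTRUCTION-SHAPED remainder is TYPED, not attempted.
This is not "finishing BSD".

Topic `NumberTheory/EllipticCurves`; namespace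
`Literature.NumberTheory.EllipticCurves.Rank1Residual.X11RankOneCertificates` (= this directory).
This file fixes the FORMAT in which the per-pair hypothesis certificates of the residual class
**X11 ∧ r = 1 ∧ ¬sst ∧ p ≥ 5** (RESIDUAL-CASES §a.2 row X11b restricted to non-semistable curves and
multiplicative primes `p ≥ 5`: `mult(p) ∧ irr(p) ∧ r_an = 1 ∧ ¬sst`, tree predicate
`Rank1Residual.ClassX11 W p` with its clause `W.analyticRank = 1 ∧ ¬ Semistable W`) enter the tree as
DATA, one record per (Cremona isogeny class, prime), in the sibling files `Records*.lean` (each states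
`Certified [r₁, …]` and is proved by `decide`, i.e. by the kernel re-running `Record.check` on the
literal data). Nothing here is a named fact and nothing is asserted about elliptic curves: what a
record CLAIMS about its curve, in the tree's vocabulary, is the `Prop` `Record.Claim` of the sibling
file `Claim.lean` (to be taken as a hypothesis, D-0014 style — exactly as
`KuriharaCertificates/Schema.lean` + `Claim.lean` do for Kurihara numbers), and `Claim.lean` proves
that the claim plus the PUBLISHED named facts give Miller's `BSD(E,p)` for the record's curve
(x11a's certificate theorems `Typed.X11.bsdp_of_katoSurj_{split,nonsplit}_of_surjective_pow_of_certificate`,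
file `Rank1Residual/Typed/PAdicCertificateMultiplicativeExists.lean`).

## What a record records, and what the kernel rechecks (`Record.check`, decidable)

For the curve `label` (Cremona; reduced global minimal model `ainvs = [a₁,a₂,a₃,a₄,a₆]`) and the prime `p`:
* `bad = [(q, v_q(N), v_q(Δ)), …]` for every bad prime `q` (increasing). RECHECKED: every `q` is prime
  (trial division; `q < 710²`), `conductor = ∏ q^{v_q(N)}`, `|Δ(ainvs)| = ∏ q^{v_q(Δ)}` with `Δ`
  RECOMPUTED from the a-invariants (so the discriminant of the model is supported exactly on the listed
  primes), `p` is listed with `v_p(N) = 1` and `v_p(Δ) > 0`, `p ∤ c₄(ainvs)` (multiplicative reduction at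
  `p` of the integral model: `p ∣ Δ`, `p ∤ c₄`), some `q` has `v_q(N) ≥ 2` (the curve is NOT
  semistable), and for every listed `q ≥ 5`: `v_q(N) = 1 ↔ q ∤ c₄` (Néron–Ogg–Shafarevich / Tate:
  multiplicative iff `q ∣ Δ, q ∤ c₄` on a minimal model) and `v_q(N) ≤ 2`;
* `split` (`a_p = +1`) / `¬split` (`a_p = −1`). RECHECKED against the a-invariants: split iff `−c₆` is
  a square mod `p` (Euler's criterion; Silverman *AEC* VII.5.1(b), `p` odd);
* `isogDegrees` = the degrees of the rational isogenies from the curve (Cremona `allisog`, row of the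
  curve, `1` included). RECHECKED: `1 ∈ isogDegrees` and `p ∤ d` for every `d` (⇒ no rational
  `p`-isogeny ⇒ `E[p]` irreducible — the CLAIM `Irr`; the list itself is Cremona's datum);
* `serre = [(ℓ₁,a_{ℓ₁}), (ℓ₂,a_{ℓ₂}), (ℓ₃,a_{ℓ₃})]`: witnesses of Serre's criterion (Serre, Invent.
  Math. 15 (1972) Prop. 19: a subgroup `G ≤ GL₂(𝔽_p)`, `p ≥ 5`, containing `s₁` with `tr² − 4 det` a
  non-zero square and `tr ≠ 0`, `s₂` with `tr² − 4 det` a non-square and `tr ≠ 0`, `s₃` with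
  `u = tr²/det ∉ {0,1,2,4}` and `u² − 3u + 1 ≠ 0`, contains `SL₂(𝔽_p)`; with `det ρ̄ = χ_p` onto, the
  image is `GL₂(𝔽_p)`), Frobenius at a good `ℓ ≠ p` having `tr = a_ℓ`, `det = ℓ`. RECHECKED: each `ℓᵢ`
  is a prime `< 64` not dividing `N p`, `a_{ℓᵢ}` is RECOMPUTED by naive point counting of the reduced
  model over `𝔽_{ℓᵢ}`, and the three mod-`p` conditions hold. (`serre = []` is allowed and means "no
  surjectivity certificate"; then `ram ≠ []` is demanded);
* `ram` = the (ram) witnesses: primes `q ≠ p` with `v_q(N) = 1` and `p ∤ v_q(Δ)` (Skinner–Urban (ram):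
  `ρ̄_{E,p}` ramified at the multiplicative prime `q`). RECHECKED from `bad`;
* `torsion`, `tamagawa = ∏ c_q`, `rank` (Mordell–Weil rank), `rootNumber`, `shaAn` (the analytic order
  of `Ш`, an integer agreed by the engines below). RECHECKED: `rank = 1`, `rootNumber = −1`,
  `p ∤ torsion`, `p ∤ shaAn`, `0 < shaAn`; `ordpTam = v_p(tamagawa)` is recorded (documentation: the
  Kolyvagin lever of the lane misses exactly when it is positive or the Heegner index is uncertified);
* `ordT`, `vS`: the COMPUTED `p`-adic certificate — `ordT = ord_{T=0} L_p(E,T)` (`= r + 1 = 2` at a split,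
  `= r = 1` at a non-split prime; Mazur–Tate–Teitelbaum) and `vS = v_p(S_p)` where `S_p` is the `p`-adic
  analytic order of `Ш` (PARI/GP `ellpadicbsd`/`ellpadicregulator`, x11a gen 4 jobs j042099/j042317/j042338;
  second engine: the literature seat's numerical-modular-symbol engine `msengine`, farm job j048000 —
  `OUT_lp141.jsonl`: 141/141 `ord_T` as expected, `v_p(S) = 0`, digit agreement with PARI at 129, the 12
  pairs with `2⁴ ∣ N` differing by PARI's factor `2`, a unit at `p ≥ 5`). RECHECKED: `ordT = 2` if split
  else `1`, `vS = 0`;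
* `engines`: provenance strings (engine T = tables + exact arithmetic, engine Y = independent pure-python
  numerics incl. Tate's algorithm / root number / `L'(E,1)` / `Ω` / BSD consistency, engine P = PARI via
  cypari2; unit `b2b-bsdres-x11c`, HOME/b2b-bsdres-x11c/), documentation only.

NOT checked here (they are CLAIMS about the curve, `Claim.lean`): that the model is globally minimal,
that `N` is the conductor, the analytic rank, `#Ш_an`, irreducibility/surjectivity of `ρ̄_{E,p}` as
Galois-theoretic statements, and the `p`-adic valuation identity behind `vS = 0`.

## Design

Plain computable data (`ℕ`, `ℤ`, `Bool`, `String`, `List`), no Mathlib structures, naive arithmetic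
(`powMod` by repeated multiplication, valuations by repeated division with fuel, trial division below
`710`, point counting by Euler's criterion), so that `decide` runs the recheck inside the kernel (no
`native_decide`, no extra axioms). `Certified rs` is a `Bool` equation with a `Decidable` instance.

References: J.-P. Serre, Invent. Math. 15 (1972) §2.8 Prop. 19 [Serre1972]; J. H. Silverman, *AEC*
VII.5.1 [SilvermanAEC2009]; C. Skinner, E. Urban, Invent. Math. 195 (2014) (ram) [SkinnerUrban2014];
B. Mazur, J. Tate, J. Teitelbaum, Invent. Math. 84 (1986) §II.10 [MazurTateTeitelbaum1986Invent];
J. E. Cremona, the elliptic curve database [Cremona2006]; cell files REPORT-g4.md…REPORT-g7.md (x11a) and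
`code/b2b-bsdres-lit/JOBS.md` (msengine).
-/

namespace Literature.NumberTheory.EllipticCurves.Rank1Residual.X11RankOneCertificates

/-- One certificate record of the class X11 ∧ `r = 1` ∧ ¬sst ∧ `p ≥ 5`: the DATA of one (Cremona class,
prime) pair, see the module docstring for the meaning of each field. A record asserts nothing by itself;
`Record.check` is its decidable recheck. [folklore] -/
structure Record where
  /-- Cremona label of the curve (curve number 1 of its isogeny class, e.g. `"2760k1"`). -/
  label : String
  /-- a-invariants `[a₁, a₂, a₃, a₄, a₆]` of the reduced global minimal model. -/
  ainvs : List ℤ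
  /-- the conductor `N`. -/
  conductor : ℕ
  /-- the prime `p` (`p ≥ 5`, `p ‖ N`). -/
  p : ℕ
  /-- `(q, v_q(N), v_q(Δ_min))` for every bad prime `q`, increasing in `q`. -/
  bad : List (ℕ × ℕ × ℕ)
  /-- `true` = split multiplicative at `p` (`a_p = +1`), `false` = non-split (`a_p = −1`). -/
  split : Bool
  /-- degrees of the rational isogenies from the curve (Cremona `allisog`), `1` included. -/
  isogDegrees : List ℕ
  /-- Serre-criterion witnesses `[(ℓ₁,a_ℓ₁),(ℓ₂,a_ℓ₂),(ℓ₃,a_ℓ₃)]` (types s₁, s₂, s₃), or `[]`. -/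
  serre : List (ℕ × ℤ)
  /-- Sutherland image codes at the non-surjective primes of the curve (Cremona `galrep`; documentation). -/
  galrep : List String
  /-- the (ram) witnesses: primes `q ≠ p`, `q ‖ N`, `p ∤ v_q(Δ_min)`. -/
  ram : List ℕ
  /-- `#E(ℚ)_tors`. -/
  torsion : ℕ
  /-- the Tamagawa product `∏_q c_q`. -/
  tamagawa : ℕ
  /-- `v_p(∏ c_q)` (documentation). -/
  ordpTam : ℕ
  /-- the Mordell–Weil rank (Cremona) = the analytic rank (engines Y, P). -/
  rank : ℕ
  /-- the global root number. -/
  rootNumber : ℤ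
  /-- the analytic order of `Ш` (an integer; engines T/Y/P agree to `10⁻⁸`). -/
  shaAn : ℕ
  /-- computed `ord_{T=0} L_p(E,T)`. -/
  ordT : ℕ
  /-- computed `v_p(S_p)`, `S_p` the `p`-adic analytic order of `Ш` (normalised leading term / regulator). -/
  vS : ℤ
  /-- `p`-adic digits to which `S_p` was determined by the two engines (min). -/
  digits : ℕ
  /-- provenance strings (engines, jobs); documentation only. -/
  engines : List String
  deriving DecidableEq

/-! ### Naive arithmetic (kernel-evaluable) -/

/-- `b ^ e mod m` by `e` repeated multiplications (`m = 0` gives `b ^ e`). [folklore] -/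
def powMod (b e m : ℕ) : ℕ := (List.range e).foldl (fun acc _ => acc * b % m) (1 % m)

/-- `v_q(n)` by repeated division, with fuel `200` (all exponents here are `< 200`); `0` for `n = 0` or
`q < 2` (junk). [folklore] -/
def natValAux : ℕ → ℕ → ℕ → ℕ
  | 0, _, _ => 0
  | fuel + 1, q, n => if q < 2 ∨ n = 0 ∨ n % q ≠ 0 then 0 else natValAux fuel q (n / q) + 1

/-- `v_q(n)` (see `natValAux`). [folklore] -/
def natVal (q n : ℕ) : ℕ := natValAux 200 q n

/-- Primality by trial division by every `d < 710`; correct for `2 ≤ q < 710² = 504100` (all conductors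
of Cremona's database are below `5·10⁵`). [folklore] -/
def isPrimeBelow504100 (q : ℕ) : Bool :=
  decide (2 ≤ q ∧ q < 504100) && (List.range 710).all (fun d => decide (d < 2 ∨ q ≤ d ∨ q % d ≠ 0))

/-- A list of naturals is strictly increasing (Bool). [folklore] -/
def strictlyIncreasing : List ℕ → Bool
  | [] => true
  | [_] => true
  | a :: b :: t => decide (a < b) && strictlyIncreasing (b :: t)

/-- The Legendre symbol `(a | ℓ)` for an odd prime `ℓ` by Euler's criterion (`0` if `ℓ ∣ a`). [folklore] -/
def legendreSym (a : ℤ) (ℓ : ℕ) : ℤ :=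
  let r := (a % (ℓ : ℤ)).toNat
  if r = 0 then 0 else if powMod r ((ℓ - 1) / 2) ℓ = 1 then 1 else -1

/-- `b₂, b₄, b₆, b₈, c₄, c₆, Δ` of `[a₁,a₂,a₃,a₄,a₆]` (Silverman *AEC* III.1; junk `0`s otherwise). [folklore] -/
def invariants : List ℤ → ℤ × ℤ × ℤ × ℤ × ℤ × ℤ × ℤ
  | [a1, a2, a3, a4, a6] =>
    let b2 := a1 * a1 + 4 * a2
    let b4 := 2 * a4 + a1 * a3
    let b6 := a3 * a3 + 4 * a6
    let b8 := a1 * a1 * a6 + 4 * a2 * a6 - a1 * a3 * a4 + a2 * a3 * a3 - a4 * a4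
    let c4 := b2 * b2 - 24 * b4
    let c6 := -(b2 * b2 * b2) + 36 * b2 * b4 - 216 * b6
    let disc := -(b2 * b2 * b8) - 8 * b4 * b4 * b4 - 27 * b6 * b6 + 9 * b2 * b4 * b6
    (b2, b4, b6, b8, c4, c6, disc)
  | _ => (0, 0, 0, 0, 0, 0, 0)

/-- `c₄` of the a-invariants. [folklore] -/
def c4Of (a : List ℤ) : ℤ := (invariants a).2.2.2.2.1
/-- `c₆` of the a-invariants. [folklore] -/
def c6Of (a : List ℤ) : ℤ := (invariants a).2.2.2.2.2.1
/-- `Δ` of the a-invariants. [folklore] -/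
def discOf (a : List ℤ) : ℤ := (invariants a).2.2.2.2.2.2

/-- `#E(𝔽_ℓ)` of the reduction of the integral model `[a₁,…,a₆]` at an ODD prime `ℓ` (all projective
points): `1 + ∑_{x mod ℓ} (1 + ((a₁x+a₃)² + 4(x³+a₂x²+a₄x+a₆) | ℓ))`. [folklore] -/
def countPoints (a : List ℤ) (ℓ : ℕ) : ℤ :=
  match a with
  | [a1, a2, a3, a4, a6] =>
    1 + ((List.range ℓ).map fun (x : ℕ) =>
      1 + legendreSym ((a1 * x + a3) * (a1 * x + a3) + 4 * ((x : ℤ) * x * x + a2 * x * x + a4 * x + a6)) ℓ).sum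
  | _ => 0

/-- `a_ℓ = ℓ + 1 − #E(𝔽_ℓ)` of the integral model at an odd prime `ℓ` of good reduction. [folklore] -/
def apNaive (a : List ℤ) (ℓ : ℕ) : ℤ := (ℓ : ℤ) + 1 - countPoints a ℓ

/-! ### The recheck -/

namespace Record

variable (r : Record)

/-- `v_q(N)` as recorded in `bad` (`0` if `q` is not listed). [folklore] -/
def vN (q : ℕ) : ℕ := ((r.bad.find? fun t => t.1 == q).map fun t => t.2.1).getD 0
/-- `v_q(Δ)` as recorded in `bad` (`0` if `q` is not listed). [folklore] -/
def vD (q : ℕ) : ℕ := ((r.bad.find? fun t => t.1 == q).map fun t => t.2.2).getD 0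

/-- Shape and support: five a-invariants; bad primes prime, increasing; `N = ∏ q^{v_q(N)}`;
`|Δ(ainvs)| = ∏ q^{v_q(Δ)}` (RECOMPUTED discriminant); every listed `q` has `v_q(Δ) > 0`. [folklore] -/
def checkSupport : Bool :=
  (r.ainvs.length == 5) &&
  r.bad.all (fun t => isPrimeBelow504100 t.1 && decide (0 < t.2.2)) &&
  strictlyIncreasing (r.bad.map (·.1)) &&
  ((r.bad.map fun t => t.1 ^ t.2.1).foldl (· * ·) 1 == r.conductor) &&
  (((r.bad.map fun t => t.1 ^ t.2.2).foldl (· * ·) 1 : ℕ) == (discOf r.ainvs).natAbs) &&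
  decide (discOf r.ainvs ≠ 0)

/-- Reduction types read off the minimal model: `p ≥ 5` prime, `v_p(N) = 1`, `p ∣ Δ`, `p ∤ c₄`
(multiplicative at `p`); split iff `(−c₆ | p) = +1`; some `v_q(N) ≥ 2` (not semistable); for listed
`q ≥ 5`: `v_q(N) ≤ 2` and (`v_q(N) = 1` iff `q ∤ c₄`). [cite: SilvermanAEC2009, Prop. VII.5.1] -/
def checkReduction : Bool :=
  decide (5 ≤ r.p) && isPrimeBelow504100 r.p && (r.vN r.p == 1) && decide (0 < r.vD r.p) &&
  decide (c4Of r.ainvs % (r.p : ℤ) ≠ 0) &&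
  (r.split == (legendreSym (-(c6Of r.ainvs)) r.p == 1)) &&
  r.bad.any (fun t => decide (2 ≤ t.2.1)) &&
  r.bad.all (fun t => decide (t.1 < 5) || (decide (t.2.1 ≤ 2) && ((t.2.1 == 1) == decide (c4Of r.ainvs % (t.1 : ℤ) ≠ 0))))

/-- Irreducibility datum: `1 ∈ isogDegrees` and no degree divisible by `p`. [folklore] -/
def checkIsog : Bool := r.isogDegrees.contains 1 && r.isogDegrees.all (fun d => decide (d % r.p ≠ 0))

/-- Serre's criterion (Prop. 19) on the three witnesses `(ℓᵢ, aᵢ)`: `ℓᵢ` odd primes `< 64` not dividing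
`N p`, `aᵢ` RECOMPUTED by point counting, and mod `p`: `s₁`: `a² − 4ℓ` a non-zero square, `a ≢ 0`;
`s₂`: a non-square, `a ≢ 0`; `s₃`: `u = a²/ℓ ∉ {0,1,2,4}`, `u² − 3u + 1 ≢ 0`. Vacuous for `serre = []`.
[cite: Serre1972, §2.8 Prop. 19] -/
def checkSerre : Bool :=
  match r.serre with
  | [] => true
  | [(l1, t1), (l2, t2), (l3, t3)] =>
    let p : ℤ := r.p
    let ok (l : ℕ) (t : ℤ) : Bool :=
      decide (3 ≤ l) && decide (l < 64) && isPrimeBelow504100 l && decide (r.conductor % l ≠ 0) &&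
        decide (l ≠ r.p) && (apNaive r.ainvs l == t)
    let sq (d : ℤ) : ℤ := legendreSym d r.p
    let d1 := t1 * t1 - 4 * l1
    let d2 := t2 * t2 - 4 * l2
    let u := (t3 * t3 % p) * (powMod (l3 % r.p) (r.p - 2) r.p : ℤ) % p
    ok l1 t1 && ok l2 t2 && ok l3 t3 &&
      decide (d1 % p ≠ 0) && (sq d1 == 1) && decide (t1 % p ≠ 0) &&
      (sq d2 == -1) && decide (t2 % p ≠ 0) &&
      decide (u ≠ 0 ∧ u ≠ 1 ∧ u ≠ 2 ∧ u ≠ 4 % p) && decide ((u * u - 3 * u + 1) % p ≠ 0)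
  | _ => false

/-- (ram) witnesses: each `q ∈ ram` is listed, `q ≠ p`, `v_q(N) = 1`, `p ∤ v_q(Δ)`; and at least one
certificate source is present (`serre ≠ []` or `ram ≠ []`). [cite: SkinnerUrban2014, Thm. 2 (ram)] -/
def checkRam : Bool :=
  r.ram.all (fun q => decide (q ≠ r.p) && (r.vN q == 1) && decide (r.vD q % r.p ≠ 0)) &&
  (!r.serre.isEmpty || !r.ram.isEmpty)

/-- Invariants and the computed certificate: `rank = 1`, `rootNumber = −1`, `p ∤ torsion`, `0 < shaAn`,
`p ∤ shaAn`, `ordpTam = v_p(tamagawa)`, `ordT = 2` (split) / `1` (non-split), `vS = 0`, `digits ≥ 1`.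
[cite: MazurTateTeitelbaum1986Invent, §II.10] -/
def checkInvariants : Bool :=
  (r.rank == 1) && (r.rootNumber == -1) && decide (r.torsion % r.p ≠ 0) && decide (0 < r.shaAn) &&
  decide (r.shaAn % r.p ≠ 0) && (r.ordpTam == natVal r.p r.tamagawa) && decide (0 < r.tamagawa) &&
  (r.ordT == (if r.split then 2 else 1)) && (r.vS == 0) && decide (1 ≤ r.digits)

/-- The full recheck of a record (conjunction of the five checks above). [folklore] -/
def check : Bool := r.checkSupport && r.checkReduction && r.checkIsog && r.checkSerre && r.checkRam && r.checkInvariants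

end Record

/-- A list of records is `Certified` when every one passes `Record.check`; this is the statement of each
generated theorem `theorem certified… : Certified [ … ] := by decide` of the files `Records*.lean`. [folklore] -/
def Certified (rs : List Record) : Prop := rs.all Record.check = true

/-- `Certified rs` is decidable (a `Bool` equation). [folklore] -/
instance Certified.instDecidable (rs : List Record) : Decidable (Certified rs) :=
  inferInstanceAs (Decidable (rs.all Record.check = true))

/-- Unpacking `Certified`: every listed record passes the recheck. [folklore] -/
theorem Certified.check_of_mem {rs : List Record} (h : Certified rs) {r : Record} (hr : r ∈ rs) :
    r.check = true :=
  List.all_eq_true.1 h r hr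

/-- Projection of a passing recheck: the reduction check holds. [folklore] -/
theorem Record.checkReduction_of_check (r : Record) (h : r.check = true) : r.checkReduction = true := by
  simp only [Record.check, Bool.and_eq_true] at h
  exact h.1.1.1.1.2

/-- Projection of a passing recheck: the invariants check holds. [folklore] -/
theorem Record.checkInvariants_of_check (r : Record) (h : r.check = true) : r.checkInvariants = true := by
  simp only [Record.check, Bool.and_eq_true] at h
  exact h.2

/-- Projection of a passing recheck: the (ram)/source check holds. [folklore] -/
theorem Record.checkRam_of_check (r : Record) (h : r.check = true) : r.checkRam = true := by
  simp only [Record.check, Bool.and_eq_true] at h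
  exact h.1.2

/-- A passing record has `5 ≤ p`. [folklore] -/
theorem Record.five_le_of_check (r : Record) (h : r.check = true) : 5 ≤ r.p := by
  have h' := r.checkReduction_of_check h
  simp only [Record.checkReduction, Bool.and_eq_true, decide_eq_true_eq] at h'
  exact h'.1.1.1.1.1.1.1

/-- A passing record has `p ∤ shaAn`, `0 < shaAn`, `rank = 1`. [folklore] -/
theorem Record.shaAn_of_check (r : Record) (h : r.check = true) :
    ¬ r.p ∣ r.shaAn ∧ 0 < r.shaAn ∧ r.rank = 1 := by
  have h' := r.checkInvariants_of_check h
  simp only [Record.checkInvariants, Bool.and_eq_true, decide_eq_true_eq, beq_iff_eq] at h'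
  refine ⟨fun hd => ?_, h'.1.1.1.1.1.1.2, h'.1.1.1.1.1.1.1.1.1⟩
  exact h'.1.1.1.1.1.2 (Nat.mod_eq_zero_of_dvd hd)

/-- A passing record has a certificate source: Serre witnesses or (ram) witnesses. [folklore] -/
theorem Record.source_of_check (r : Record) (h : r.check = true) : r.serre ≠ [] ∨ r.ram ≠ [] := by
  have h' := r.checkRam_of_check h
  simp only [Record.checkRam, Bool.and_eq_true, Bool.or_eq_true, Bool.not_eq_true',
    List.isEmpty_eq_false_iff, ne_eq] at h'
  rcases h'.2 with h1 | h1
  · exact Or.inl (by simpa [List.isEmpty_iff] using h1)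
  · exact Or.inr (by simpa [List.isEmpty_iff] using h1)

-- `decide` unfolds `List.foldl`/`List.all` over `List.range 710` (trial division) and `List.range ℓ` (point
-- counting, `ℓ < 64`); the default recursion depth is too small for these literal lists.
set_option maxRecDepth 100000

/-- SAMPLE (and regression test of the recheck): the record of `2760k1 @ 5` (the first pair of the
class; `N = 2³·3·5·23`, split, `ρ̄_{E,5}` surjective with Serre witnesses at `ℓ = 7, 11, 37`, (ram)
witness `23` (`v₂₃(Δ) = 3`), `∏c = 300`, `#Ш_an = 1`, `ord_T L_5 = 2`, `v_5(S_5) = 0`) passes. [folklore] -/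
theorem certified_sample : Certified [
  { label := "2760k1", ainvs := [0, 1, 0, 7615, 1127283], conductor := 2760, p := 5,
    bad := [(2, 3, 8), (3, 1, 10), (5, 1, 5), (23, 1, 3)], split := true, isogDegrees := [1],
    serre := [(7, -3), (11, -4), (37, 1)], galrep := [], ram := [23], torsion := 1, tamagawa := 300,
    ordpTam := 2, rank := 1, rootNumber := -1, shaAn := 1, ordT := 2, vS := 0, digits := 2,
    engines := ["T", "Y", "P:j063849", "Lp:PARI j042099", "Lp:msengine j048000"] } ] := by
  decide

/-- Tampering is caught: the same record with `split := false` fails (the kernel finds `(−c₆ | 5) = +1`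
and `ordT = 2 ≠ 1`). [folklore] -/
theorem not_certified_tampered : ¬ Certified [
  { label := "2760k1", ainvs := [0, 1, 0, 7615, 1127283], conductor := 2760, p := 5,
    bad := [(2, 3, 8), (3, 1, 10), (5, 1, 5), (23, 1, 3)], split := false, isogDegrees := [1],
    serre := [(7, -3), (11, -4), (37, 1)], galrep := [], ram := [23], torsion := 1, tamagawa := 300,
    ordpTam := 2, rank := 1, rootNumber := -1, shaAn := 1, ordT := 2, vS := 0, digits := 2,
    engines := [] } ] := by
  decide

end Literature.NumberTheory.EllipticCurves.Rank1Residual.X11RankOneCertificates
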